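import Summits.KontsevichZagierPeriods.Zeta5Search.LaiSweepShard

/-!
# `κ₃` sweep certificate — shard file 067 of 127 (shards 469–475 of 889)

HONEST FRAMING. Systematic search; no irrationality claim unless certified. This file only checks,
by `decide +kernel`, shards 469–475 of the order-cell sweep of the `κ₃` point `(74, 2180, 444; δ74)`
(engine `LaiSweepEngine`, soundness `LaiSweepJump/Free/Eval/Shard/Kappa3`; a shard is `⟨regime, n,
p, q, p', q', Lo, Up⟩`: `n` cells from `p/q` to `p'/q'` with integer rate sums in `[Lo, Up]`, `K =
128`, `D = 2^40`). It draws NO conclusion: only the capstone `LaiKappa3SweepCert`, which needs all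
127 shard files, does. Kernel cost of this file ≈ 560 cells × 0.3 s.
-/

namespace Summit.KontsevichZagierPeriods.Zeta5Search.Sweep

set_option maxHeartbeats 100000000 in
/-- Shard 469: 80 cells of regime B from `101/214` to `53/112`.
[cite: Lai2024BallRivoal, §4 Lemma 4.3] -/
theorem shard469 :
    Shard.check 128 (2^40)
      ⟨true, 80, 101, 214, 53, 112, 15597787482572, 18615155725562⟩ = true := by
  decide +kernel

set_option maxHeartbeats 100000000 in
/-- Shard 470: 80 cells of regime B from `53/112` to `121/255`.
[cite: Lai2024BallRivoal, §4 Lemma 4.3] -/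
theorem shard470 :
    Shard.check 128 (2^40)
      ⟨true, 80, 53, 112, 121, 255, 16123500853374, 19260591603112⟩ = true := by
  decide +kernel

set_option maxHeartbeats 100000000 in
/-- Shard 471: 80 cells of regime B from `121/255` to `157/330`.
[cite: Lai2024BallRivoal, §4 Lemma 4.3] -/
theorem shard471 :
    Shard.check 128 (2^40)
      ⟨true, 80, 121, 255, 157, 330, 15507620823067, 18541733834354⟩ = true := by
  decide +kernel

set_option maxHeartbeats 100000000 in
/-- Shard 472: 80 cells of regime B from `157/330` to `83/174`.
[cite: Lai2024BallRivoal, §4 Lemma 4.3] -/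
theorem shard472 :
    Shard.check 128 (2^40)
      ⟨true, 80, 157, 330, 83, 174, 15554052928058, 18614417608334⟩ = true := by
  decide +kernel

set_option maxHeartbeats 100000000 in
/-- Shard 473: 80 cells of regime B from `83/174` to `197/412`.
[cite: Lai2024BallRivoal, §4 Lemma 4.3] -/
theorem shard473 :
    Shard.check 128 (2^40)
      ⟨true, 80, 83, 174, 197, 412, 14165135288863, 16966823059626⟩ = true := by
  decide +kernel

set_option maxHeartbeats 100000000 in
/-- Shard 474: 80 cells of regime B from `197/412` to `117/244`.
[cite: Lai2024BallRivoal, §4 Lemma 4.3] -/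
theorem shard474 :
    Shard.check 128 (2^40)
      ⟨true, 80, 197, 412, 117, 244, 16695942752106, 20016759800389⟩ = true := by
  decide +kernel

set_option maxHeartbeats 100000000 in
/-- Shard 475: 80 cells of regime B from `117/244` to `162/337`.
[cite: Lai2024BallRivoal, §4 Lemma 4.3] -/
theorem shard475 :
    Shard.check 128 (2^40)
      ⟨true, 80, 117, 244, 162, 337, 14832763670933, 17799531785058⟩ = true := by
  decide +kernel

/-- The checked shards of this file, in order. [folklore] -/
def shards067 : List (CheckedShard 128 (2^40)) :=
  [⟨_, shard469⟩, ⟨_, shard470⟩, ⟨_, shard471⟩, ⟨_, shard472⟩, ⟨_, shard473⟩,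
    ⟨_, shard474⟩, ⟨_, shard475⟩]

end Summit.KontsevichZagierPeriods.Zeta5Search.Sweep
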